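import Summits.ABC.IUTFork.Cor312LicenceShallowConcreteDatumQuad
import Summits.ABC.IUTFork.Cor312LicenceShallowMultiSlotF7
import Summits.ABC.IUTFork.Cor312LicenceShallowRealising
import Summits.ABC.IUTFork.Cor312PilotIdelesPrCapstone
import HarnessLib

/-!
# [IUTchIII] Cor. 3.12 — the REALISING pilot datum at the boundary of the tame multi-slot window, part 2 (the licence):
# at `X72 = (ℚ(√7), 7⁻⁵, {v₇}, 5)` the (xi-f) licence, branch C's antecedent and the typed Statement hold for REALISING ideles

PROOF-ONLY record file (D-0012; 0 definitions, 0 `Prop` facts) of the abc-iut cell (block C / W6 cone prover abc-iut-w6-d114,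
gen 4; row «X72-REALISING», sequel of the definition-bearing part 1 `Cor312LicenceShallowConcreteDatumQuad`; BY-NAME consumer of
abc-iut-w5-d180's ℚ(√7) inhabitant `Cor312LicenceShallowMultiSlotF7` (p442550), nothing of it restated). TAKES NO SIDE on
[IUTchIII] Cor. 3.12 or on any author: every statement is about OUR typed objects — abc-iut-c312-7's print-normalised sharp real
setting `Real.settingPrVolSharp` / abc-iut-c312-3's `Real.settingDHVolSharp` over abc-iut-c312-5's Dupuy–Hilado-level real
log-shells, sharp Θ-boxes and `q`-centres read off ideles REALISING `P_Θ`, `P_q` (Dupuy–Hilado (3.4)).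

abc-iut-w5-d180's p442550 gives the licence over `F7 = ℚ(√7)` for ideles of the SHAPE `‖t_q‖ = ‖ϖ‖`, `‖t_{Θ,i}‖ = ‖ϖ‖^{(i+1)²}` at
`v₇`. At part 1's datum `X72` (`P_q(v₇) = 1`, `e = 2`) that shape IS the realising form:

* §3 **`realisingShape_X72`** — realising ideles of `X72` (abc-iut-c312-7's `ht`/`htq`) satisfy abc-iut-w5-d180's `h7` at every fibre
  point over `7` (`‖t_q‖ = 7^{−1/2} = ‖ϖ‖`, `‖t_{Θ,i}‖ = ‖t_q‖^{(i+1)²}`).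
* §4 **`licence_settingPrVolSharp_concreteDatumQuad`** / `…DHVolSharp…`, **`exists_qPinned_and_hull_settingPrVolSharp_concreteDatumQuad`**
  — at `X72`, for EVERY family of realising ideles and every structural binder, with NO arithmetic hypothesis left; hence
  (abc-iut-c312-1's `statement_of_licence`, abc-iut-c312-7's `bridgeHyps_settingPrVolSharp_of_ideles` / `statement_settingPrVolSharp_iff`
  — the latter needs the realising `htq`, which shape-only ideles do not supply) **`statement_settingPrVolSharp_concreteDatumQuad`**
  and `thetaSide_settingPrVolSharp_concreteDatumQuad`: `−(ln 7)/2 ≤ −|log Θ|`.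
* §5 **`exists_realising_ideles_licence_concreteDatumQuad`** — packaged NON-VACUITY with `analyticLogv F7`: ideles REALISING `P_q`,
  `P_Θ` of `X72` EXIST (`Cor312Prov.exists_realising_…`, `2l = 10 ∣ ord_v(q_v) = 10`) and for them the `Licence` and the typed
  `Statement` hold at `settingPrVolSharp X72 …`.

READING (neutral; numbers, not adjectives). With p441984/p442096 (ℚ(⁵√7), inside the one-factor window) and p442550 this records the
boundary datum of the inhabited side in the REALISING normalisation the C-cert certificates use; `not_lastSlot_window_X72` (part 1)
shows p439445 does not reach it. The typed `Statement` at ONE shallow PilotData-level point (`|log(q)| = (ln 7)/2`) carries no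
Diophantine content; K-level / initial-Θ-data genuineness (abc-iut-C-cert-3 v5K) is NOT claimed. HONEST SCOPE as in the parents:
OUR typed sharp containers and Dupuy–Hilado's typed (Ind2); the licence is a STRONGER-THAN-PRINT set-level form; nothing about the
printed GLOBAL inequality; nothing asserts or refutes [IUTchIII] Cor. 3.12. [cite: DupuyHilado2025, §3.3, §3.4, §3.9, §4.9]
[cite: NeukirchANT1999, Ch. II Prop. (5.5)] [cite: Mochizuki2012, IUTchI Ex. 3.2 (iv) p. 71] [claim: Mochizuki2012, status: disputed]
for every IUT sentence quoted. typed ≠ proved; instantiated ≠ endorsed.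
-/

noncomputable section

/-! ## §3. Realising ideles at `X72` have abc-iut-w5-d180's shape `‖t_q‖ = ‖ϖ‖`, `‖t_{Θ,i}‖ = ‖ϖ‖^{(i+1)²}` -/

namespace Summit.ABC.IUTFork.Thm311.Real

open Set Metric Function NumberField IsDedekindDomain
open Cor312 Cor312.Setting Cor312Vol Literature.IUT.LogThetaLattice Literature.IUT.LogVolume
open Literature.NumberTheory.NumberFields Literature.NumberTheory.GaloisRepresentations.Ultrametric
open Summit.ABC.IUTFork.RamifiedMover
open Summit.ABC.IUTFork.ConcreteDatumQuad

variable {logv : PadicLogs ↥F7} (hlog : LogvAnalytic logv)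
  (M : Type) [Field M] [NumberField M]
  (archPk : ∀ (j : (thetaIndex X72).Label) (vQ : (thetaIndex X72).VQ), Set ((logShellsDH X72 logv).Packet j vQ))
  (archSub : ∀ (j : (thetaIndex X72).Label) (v : (thetaIndex X72).V),
    Set ((logShellsDH X72 logv).Packet j ((thetaIndex X72).over v)))
  (Ψ : ℤ → ∀ v : (thetaIndex X72).V, v ∈ (thetaIndex X72).Vbad → Set ((logShellsDH X72 logv).StarPacket v))
  (act : ℤ → ∀ v : (thetaIndex X72).V, v ∈ (thetaIndex X72).Vbad →
    (logShellsDH X72 logv).StarPacket v → Module.End ℚ ((logShellsDH X72 logv).StarPacket v))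
  (Mmod : ℤ → ∀ j : (thetaIndex X72).LabelStar, Set ((logShellsDH X72 logv).GlobalPacket j.1))
  (region : ℤ → ∀ j : (thetaIndex X72).LabelStar, FinDivisor M → ∀ vQ : (thetaIndex X72).VQ,
    Set ((logShellsDH X72 logv).Packet j.1 vQ))
  (n : ℤ) {HT : Type} {LogLink : HT → HT → Type} {IsFull : ∀ {s t : HT}, LogLink s t → Prop}
  (lat : LGPGaussianLogThetaLattice LogLink IsFull)
  {Frd : Type} {IsoF : Frd → Frd → Type} {Ob : Frd → Type} {realify : Frd → Frd} {Strip : Type}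
  {IsoS : Strip → Strip → Type} {Mv : ∀ v : (thetaIndex X72).V, v ∈ (thetaIndex X72).Vbad → Type}
  [∀ v h, Monoid (Mv v h)]
  (sig : GlobalLGPFrobenioidSignature (thetaIndex X72).lstar (thetaIndex X72).V (· ∈ (thetaIndex X72).Vbad)
    Frd IsoF Ob realify Strip IsoS Mv)
  (split : SplittingMonoids Mv) {ObΔ : Type} {N : ∀ v : (thetaIndex X72).V, v ∈ (thetaIndex X72).Vbad → Type}
  [∀ v h, Monoid (N v h)] (qData : QPilotData ObΔ N)
  (tq : ∀ (pp : Nat.Primes) (x : (thetaIndex X72).Fibre (.inr pp)), haveI : Fact (pp : ℕ).Prime := ⟨pp.2⟩; kOf X72 pp.1 x)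
  (t : ∀ (pp : Nat.Primes) (_ : Fin X72.lstar) (x : (thetaIndex X72).Fibre (.inr pp)),
    haveI : Fact (pp : ℕ).Prime := ⟨pp.2⟩; kOf X72 pp.1 x)
  (htq0 : ∀ pp x, tq pp x ≠ 0)
  (htq1 : ∀ (pp : Nat.Primes) (x : (thetaIndex X72).Fibre (.inr pp)),
    haveI : Fact (pp : ℕ).Prime := ⟨pp.2⟩; placeOf X72 pp.1 x ∉ X72.S → ‖tq pp x‖ = 1)
  (col : ℤ → Column (logShellsDH X72 logv))
  (ht0 : ∀ pp i x, t pp i x ≠ 0)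
  (ht : ∀ (pp : Nat.Primes) (i : Fin X72.lstar) (x : (thetaIndex X72).Fibre (.inr pp)),
    haveI : Fact (pp : ℕ).Prime := ⟨pp.2⟩
    Real.log ‖t pp i x‖ = -(X72.thetaPilot i (placeOf X72 pp.1 x)) * logNorm ↥F7 (placeOf X72 pp.1 x) /
      localDegree ↥F7 (placeOf X72 pp.1 x))
  (htq : ∀ (pp : Nat.Primes) (x : (thetaIndex X72).Fibre (.inr pp)),
    haveI : Fact (pp : ℕ).Prime := ⟨pp.2⟩
    Real.log ‖tq pp x‖ = -(X72.qPilot (placeOf X72 pp.1 x)) * logNorm ↥F7 (placeOf X72 pp.1 x) /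
      localDegree ↥F7 (placeOf X72 pp.1 x))

include ht0 ht htq0 htq in
/-- **Realising ⇒ shape at `X72`**: for ideles REALISING `P_q`, `P_Θ` of `X72` (abc-iut-c312-7's `ht`/`htq`), at every fibre point
over `7` (which IS `v₇`, abc-iut-w5-d180's `placeOf_p7_eq_v7`) there is a uniformizer `ϖ` with **`‖t_q‖ = ‖ϖ‖`** (`= 7^{−P_q/e} =
7^{−1/2}`, `P_q(v₇) = 1`, `e = 2`) and **`‖t_{Θ,i}‖ = ‖ϖ‖^{(i+1)²}`** — exactly the hypothesis `h7` of abc-iut-w5-d180's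
`licence_settingPrVolSharp_F7`. [cite: DupuyHilado2025, §3.3, §3.4] [cite: NeukirchANT1999, Ch. II Prop. (5.5)] -/
theorem realisingShape_X72 (w : (thetaIndex X72).Fibre (.inr p7)) :
    haveI : Fact (p7 : ℕ).Prime := ⟨p7.2⟩
    ∃ ϖ : (kOf X72 p7.1 w)ˣ, IsUniformizer ϖ ∧ ‖tq p7 w‖ = ‖(ϖ : kOf X72 p7.1 w)‖ ∧
      ∀ i : Fin X72.lstar, ‖t p7 i w‖ = ‖(ϖ : kOf X72 p7.1 w)‖ ^ (((i : ℕ) + 1) ^ 2) := by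
  haveI : Fact (p7 : ℕ).Prime := ⟨p7.2⟩
  have hw7 : placeOf X72 p7.1 w = v7 := placeOf_p7_eq_v7 X72 w
  have hwS : placeOf X72 p7.1 w ∈ X72.S := by
    rw [hw7, X72_S]
    exact Finset.mem_singleton_self _
  have he2 : (placeOf X72 p7.1 w).asIdeal.ramificationIdx ℤ = 2 := by
    rw [hw7]
    exact ramificationIdx_v7
  have hr2 : ramIdx ↥F7 (placeOf X72 p7.1 w) = 2 := by
    rw [ramIdx_eq, he2]
  obtain ⟨ϖ, hϖ, hϖn⟩ :=
    exists_isUniformizer_rescaledCompletion ↥F7 p7.1 (placeOf X72 p7.1 w) (natCast_mem_placeOf X72 p7.1 w)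
  rw [he2] at hϖn
  have hnq : ‖tq p7 w‖ = ‖(ϖ : kOf X72 p7.1 w)‖ := by
    rw [norm_qIdele_eq_rpow_of_realises X72 tq htq0 htq p7 w, X72_qPilot hwS, hr2,
      show ‖(ϖ : kOf X72 p7.1 w)‖ = ((p7 : ℕ) : ℝ) ^ (-(1 / ((2 : ℕ) : ℝ))) from hϖn]
    norm_num
  refine ⟨ϖ, hϖ, hnq, fun i => ?_⟩
  rw [← hnq]
  exact norm_thetaIdele_eq_pow_of_realises X72 t ht0 ht tq htq0 htq p7 i w

/-! ## §4. The licence, branch C's antecedent, the typed Statement and the Θ-side at `X72`, for every family of realising ideles -/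

include ht0 ht htq in
/-- **THE (xi-f) LICENCE AT `settingDHVolSharp X72 …` FOR EVERY FAMILY OF REALISING IDELES — no arithmetic hypothesis**
(abc-iut-w5-d180's `licence_settingDHVolSharp_F7` with `hl := X72_lstar`, `hS := eq_v7_of_mem_X72_S`, `h7 := realisingShape_X72`).
[cite: DupuyHilado2025, §3.4, §3.9, §4.9] [claim: Mochizuki2012, status: disputed] -/
theorem licence_settingDHVolSharp_concreteDatumQuad :
    Thm311ToCor312.Licence (settingDHVolSharp X72 hlog M archPk archSub Ψ act Mmod region n lat sig split qData tq t htq0 htq1) :=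
  licence_settingDHVolSharp_F7 X72 hlog M archPk archSub Ψ act Mmod region n lat sig split qData tq t htq0 htq1 X72_lstar
    eq_v7_of_mem_X72_S (fun pp i x hx => norm_eq_one_of_realises X72 t ht0 ht pp i x hx)
    fun w => realisingShape_X72 tq t htq0 ht0 ht htq w

include ht0 ht htq in
/-- **THE (xi-f) LICENCE AT THE PRINT-NORMALISED SHARP SETTING `settingPrVolSharp X72 …` FOR EVERY FAMILY OF REALISING IDELES.**
[cite: DupuyHilado2025, §3.4, §3.9, §4.9] [claim: Mochizuki2012, status: disputed] -/
theorem licence_settingPrVolSharp_concreteDatumQuad :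
    Thm311ToCor312.Licence (settingPrVolSharp X72 hlog M archPk archSub Ψ act Mmod region n lat sig split qData tq t htq0 htq1) :=
  licence_settingPrVolSharp_F7 X72 hlog M archPk archSub Ψ act Mmod region n lat sig split qData tq t htq0 htq1 X72_lstar
    eq_v7_of_mem_X72_S (fun pp i x hx => norm_eq_one_of_realises X72 t ht0 ht pp i x hx)
    fun w => realisingShape_X72 tq t htq0 ht0 ht htq w

include ht0 ht htq in
/-- **BRANCH C's ANTECEDENT «`∃ ρ qK, QPinned ∧ PilotKummerCompatHull`» IS INHABITED at `settingPrVolSharp X72 …`** for every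
family of realising ideles and every column structure (abc-iut-w5-d180's `exists_qPinned_and_hull_settingPrVolSharp_F7`).
[cite: DupuyHilado2025, §3.4, §3.9, §4.9] [claim: Mochizuki2012, status: disputed] -/
theorem exists_qPinned_and_hull_settingPrVolSharp_concreteDatumQuad :
    ∃ (ρ : (∀ v : (thetaIndex X72).V, v ∈ (thetaIndex X72).Vbad → Set ((logShellsDH X72 logv).StarPacket v)) →
          ∀ (j : (thetaIndex X72).Label) (vQ : (thetaIndex X72).VQ), Set ((logShellsDH X72 logv).Packet j vQ))
        (qK : ∀ v : (thetaIndex X72).V, v ∈ (thetaIndex X72).Vbad → Set ((logShellsDH X72 logv).StarPacket v)),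
        QPinned ({ toSituation := situationPrVol X72 hlog M archPk archSub Ψ act Mmod region, col := col } :
            LatticeSituation (thetaIndex X72))
          (settingPrVolSharp X72 hlog M archPk archSub Ψ act Mmod region n lat sig split qData tq t htq0 htq1) ρ qK ∧
        PilotKummerCompatHull ({ toSituation := situationPrVol X72 hlog M archPk archSub Ψ act Mmod region, col := col } :
            LatticeSituation (thetaIndex X72))
          (settingPrVolSharp X72 hlog M archPk archSub Ψ act Mmod region n lat sig split qData tq t htq0 htq1) ρ qK :=
  exists_qPinned_and_hull_settingPrVolSharp_F7 X72 hlog M archPk archSub Ψ act Mmod region n lat sig split qData tq t htq0 htq1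
    col X72_lstar eq_v7_of_mem_X72_S (fun pp x => norm_qIdele_le_one_of_realises X72 tq htq0 htq pp x)
    (fun pp i x hx => norm_eq_one_of_realises X72 t ht0 ht pp i x hx) fun w => realisingShape_X72 tq t htq0 ht0 ht htq w

include ht0 ht htq in
/-- **THE TYPED `Statement` OF [IUTchIII] COR. 3.12 AT `settingPrVolSharp X72 …` FOR EVERY FAMILY OF REALISING IDELES**
(abc-iut-c312-1's `statement_of_licence` + abc-iut-c312-7's `bridgeHyps_settingPrVolSharp_of_ideles`). HONEST READING: one
PilotData-level point with `|log(q)| = (ln 7)/2` in the sharp Dupuy–Hilado reading; no Diophantine content.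
[cite: DupuyHilado2025, §3.4, §3.9, §4.9] [claim: Mochizuki2012, status: disputed] -/
theorem statement_settingPrVolSharp_concreteDatumQuad :
    (settingPrVolSharp X72 hlog M archPk archSub Ψ act Mmod region n lat sig split qData tq t htq0 htq1).Statement :=
  Thm311ToCor312.statement_of_licence
    (bridgeHyps_settingPrVolSharp_of_ideles X72 hlog M archPk archSub Ψ act Mmod region n lat sig split qData t tq ht0
      (fun pp i x hx => norm_eq_one_of_realises X72 t ht0 ht pp i x hx) htq0 htq1)
    (licence_settingPrVolSharp_concreteDatumQuad hlog M archPk archSub Ψ act Mmod region n lat sig split qData tq t htq0 htq1 ht0 ht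
      htq)

include ht0 ht htq in
/-- **THE TYPED Θ-SIDE INEQUALITY AT `X72`: `−(ln 7)/2 ≤ −|log Θ|`** at `settingPrVolSharp X72 …` (abc-iut-c312-7's
`statement_settingPrVolSharp_iff`, `ndeg_qPilot_X72`). [cite: DupuyHilado2025, §3.3, §3.4] [claim: Mochizuki2012, status: disputed] -/
theorem thetaSide_settingPrVolSharp_concreteDatumQuad :
    (((-(Real.log 7 / 2) : ℝ)) : WithTop ℝ) ≤
      (settingPrVolSharp X72 hlog M archPk archSub Ψ act Mmod region n lat sig split qData tq t htq0 htq1).negLogTheta := by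
  rw [← ndeg_qPilot_X72]
  exact (statement_settingPrVolSharp_iff X72 hlog M archPk archSub Ψ act Mmod region n lat sig split qData t tq ht0
      (fun pp i x hx => norm_eq_one_of_realises X72 t ht0 ht pp i x hx) htq0 htq1 htq).1
    (statement_settingPrVolSharp_concreteDatumQuad hlog M archPk archSub Ψ act Mmod region n lat sig split qData tq t htq0 htq1 ht0
      ht htq)

end Summit.ABC.IUTFork.Thm311.Real

/-! ## §5. Packaged non-vacuity: realising ideles EXIST at `X72`, and for them the licence and the typed Statement hold -/

namespace Summit.ABC.IUTFork.Thm311.Real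

open Set Metric Function NumberField IsDedekindDomain
open Cor312 Cor312.Setting Cor312Vol Literature.IUT.LogThetaLattice Literature.IUT.LogVolume
open Literature.NumberTheory.NumberFields Literature.NumberTheory.GaloisRepresentations.Ultrametric
open Summit.ABC.IUTFork.RamifiedMover
open Summit.ABC.IUTFork.ConcreteDatumQuad

/-- **NON-VACUITY AT THE QUADRATIC DATUM, PACKAGED.** With the analytic logarithms `analyticLogv F7` there EXIST q- and Θ-ideles on
the completions of `F7 = ℚ(√7)`, non-zero, units off `S = V(F7)₇`, REALISING `P_q`, `P_Θ` of `X72` (`Cor312Prov.exists_realising_…`,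
since `2l = 10 ∣ ord_v(q_v) = 10`), such that for EVERY structural binder of the print-normalised sharp setting the (xi-f) `Licence`
and the typed `Statement` of Cor. 3.12 hold at `settingPrVolSharp X72 …`. [cite: DupuyHilado2025, §3.3, §3.4, §3.9, §4.9]
[cite: Mochizuki2012, IUTchI Ex. 3.2 (iv) p. 71] [claim: Mochizuki2012, status: disputed] -/
theorem exists_realising_ideles_licence_concreteDatumQuad :
    ∃ (tq : ∀ (pp : Nat.Primes) (x : (thetaIndex X72).Fibre (.inr pp)), haveI : Fact (pp : ℕ).Prime := ⟨pp.2⟩; kOf X72 pp.1 x)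
      (t : ∀ (pp : Nat.Primes) (_ : Fin X72.lstar) (x : (thetaIndex X72).Fibre (.inr pp)),
        haveI : Fact (pp : ℕ).Prime := ⟨pp.2⟩; kOf X72 pp.1 x)
      (htq0 : ∀ pp x, tq pp x ≠ 0)
      (htq1 : ∀ (pp : Nat.Primes) (x : (thetaIndex X72).Fibre (.inr pp)),
        haveI : Fact (pp : ℕ).Prime := ⟨pp.2⟩; placeOf X72 pp.1 x ∉ X72.S → ‖tq pp x‖ = 1),
      (∀ pp i x, t pp i x ≠ 0) ∧
      (∀ (pp : Nat.Primes) (i : Fin X72.lstar) (x : (thetaIndex X72).Fibre (.inr pp)),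
          haveI : Fact (pp : ℕ).Prime := ⟨pp.2⟩; placeOf X72 pp.1 x ∉ X72.S → ‖t pp i x‖ = 1) ∧
      (∀ (pp : Nat.Primes) (i : Fin X72.lstar) (x : (thetaIndex X72).Fibre (.inr pp)),
          haveI : Fact (pp : ℕ).Prime := ⟨pp.2⟩
          Real.log ‖t pp i x‖ = -(X72.thetaPilot i (placeOf X72 pp.1 x)) * logNorm ↥F7 (placeOf X72 pp.1 x) /
            localDegree ↥F7 (placeOf X72 pp.1 x)) ∧
      (∀ (pp : Nat.Primes) (x : (thetaIndex X72).Fibre (.inr pp)),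
          haveI : Fact (pp : ℕ).Prime := ⟨pp.2⟩
          Real.log ‖tq pp x‖ = -(X72.qPilot (placeOf X72 pp.1 x)) * logNorm ↥F7 (placeOf X72 pp.1 x) /
            localDegree ↥F7 (placeOf X72 pp.1 x)) ∧
      ∀ (M : Type) [Field M] [NumberField M]
        (archPk : ∀ (j : (thetaIndex X72).Label) (vQ : (thetaIndex X72).VQ),
          Set ((logShellsDH X72 (analyticLogv ↥F7)).Packet j vQ))
        (archSub : ∀ (j : (thetaIndex X72).Label) (v : (thetaIndex X72).V),
          Set ((logShellsDH X72 (analyticLogv ↥F7)).Packet j ((thetaIndex X72).over v)))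
        (Ψ : ℤ → ∀ v : (thetaIndex X72).V, v ∈ (thetaIndex X72).Vbad →
          Set ((logShellsDH X72 (analyticLogv ↥F7)).StarPacket v))
        (act : ℤ → ∀ v : (thetaIndex X72).V, v ∈ (thetaIndex X72).Vbad →
          (logShellsDH X72 (analyticLogv ↥F7)).StarPacket v →
            Module.End ℚ ((logShellsDH X72 (analyticLogv ↥F7)).StarPacket v))
        (Mmod : ℤ → ∀ j : (thetaIndex X72).LabelStar, Set ((logShellsDH X72 (analyticLogv ↥F7)).GlobalPacket j.1))
        (region : ℤ → ∀ j : (thetaIndex X72).LabelStar, FinDivisor M → ∀ vQ : (thetaIndex X72).VQ,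
          Set ((logShellsDH X72 (analyticLogv ↥F7)).Packet j.1 vQ))
        (n : ℤ) (HT : Type) (LogLink : HT → HT → Type) (IsFull : ∀ {s t : HT}, LogLink s t → Prop)
        (lat : LGPGaussianLogThetaLattice LogLink IsFull)
        (Frd : Type) (IsoF : Frd → Frd → Type) (Ob : Frd → Type) (realify : Frd → Frd) (Strip : Type)
        (IsoS : Strip → Strip → Type) (Mv : ∀ v : (thetaIndex X72).V, v ∈ (thetaIndex X72).Vbad → Type)
        (_ : ∀ v h, Monoid (Mv v h))
        (sig : GlobalLGPFrobenioidSignature (thetaIndex X72).lstar (thetaIndex X72).V (· ∈ (thetaIndex X72).Vbad)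
          Frd IsoF Ob realify Strip IsoS Mv)
        (split : SplittingMonoids Mv) (ObΔ : Type) (N : ∀ v : (thetaIndex X72).V, v ∈ (thetaIndex X72).Vbad → Type)
        (_ : ∀ v h, Monoid (N v h)) (qData : QPilotData ObΔ N),
        Thm311ToCor312.Licence (settingPrVolSharp X72 (logvAnalytic_analyticLogv (F := ↥F7)) M archPk archSub Ψ act Mmod
            region n lat sig split qData tq t htq0 htq1) ∧
        (settingPrVolSharp X72 (logvAnalytic_analyticLogv (F := ↥F7)) M archPk archSub Ψ act Mmod
            region n lat sig split qData tq t htq0 htq1).Statement := by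
  obtain ⟨tq, htq0, htq1, htq⟩ := Cor312Prov.exists_realising_qIdeles_of_twoMulLDvdOrdq X72 twoMulLDvdOrdq_X72
  obtain ⟨t, ht0, ht1, ht⟩ := Cor312Prov.exists_realising_thetaIdeles_of_twoMulLDvdOrdq X72 twoMulLDvdOrdq_X72
  refine ⟨tq, t, htq0, htq1, ht0, ht1, ht, htq, ?_⟩
  intro M _ _ archPk archSub Ψ act Mmod region n HT LogLink IsFull lat Frd IsoF Ob realify Strip IsoS Mv _ sig split ObΔ N _
    qData
  exact ⟨licence_settingPrVolSharp_concreteDatumQuad (logvAnalytic_analyticLogv (F := ↥F7)) M archPk archSub Ψ act Mmod region n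
      lat sig split qData tq t htq0 htq1 ht0 ht htq,
    statement_settingPrVolSharp_concreteDatumQuad (logvAnalytic_analyticLogv (F := ↥F7)) M archPk archSub Ψ act Mmod region n
      lat sig split qData tq t htq0 htq1 ht0 ht htq⟩

end Summit.ABC.IUTFork.Thm311.Real

end
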